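import Literature.LinearAlgebra.InverseBilinearFormTransport
import Literature.NumberTheory.Automorphic.Liu2021.AppendixC.EtaleH1TowerPairing
import HarnessLib

/-!
# [Liu 2021, §4.2] the form on the étale tower `H¹_ét(A_∞) = colim_K (V_ℓ A_K)^∨` FROM LEVEL-WISE DATA ON `V_ℓ A_K` — inverse forms of
# non-degenerate level pairings, adjoint pairs along the Hecke translates (the V-side socket of the tower road toward `SocketRos`)

Topic `NumberTheory/Automorphic/Liu2021/AppendixC`; namespace `Literature.NumberTheory.Automorphic.Liu2021.AppendixC.Sec42Data.HeckeTranslates`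
(§1–§2) and `….Sec42Data` (§3).  THEOREMS ONLY (no definition, no named fact, no instance, no `sorry`); ∃-form.  Cell `hodgecm-mathlib` (D-0151),
fan A, count-neutral capital (`--supports stmt-HodgeConjecture-24832`): leg (T2d) of the tower road (P) (director g11 s211; A-plan2 (g12) d6 pen),
the COROLLARY packaging ★ (T2c) `Literature.LinearAlgebra.InverseBilinearFormTransport` with ★ (T2b) `AppendixC.EtaleH1TowerPairing`: the producers
((F-P2) [LangeRodriguez2022 (3.3)] through the Θ-pinned export ★ `WeilPairingRationalTateModulePinned`, Q1 ★ `JacobianGaloisCoverNorm`, the transfer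
lemmas (tr-1..3)) speak on `V_ℓ A_K`; this file turns their V-side output into the invariant tower form on the DUAL side in one call.  HC_CM is proved
only modulo the 7 printed citations until rung 0 closes; nothing of [Liu2021] is asserted here (plumbing on the tree's CONSTRUCTED tower).

INPUT (per level `K`, on `V_K := V_ℓ(A_K) = (C.A K).rationalTateModule ℓ`): bilinear forms `eV K` with bijective associated maps
(`[(eV K).IsPerfPair]` — over `ℚ_ℓ` in finite dimension this is `Nondegenerate`, ★ `Literature.LinearAlgebra.isPerfPair_of_nondegenerate`), weights
`w K : ℚ_ℓ`, and for every translate `T_g : X_L → X_K` (`g⁻¹Lg ⊆ K`, ★ `C5.HeckeLE`) an ADJOINT `t : V_K → V_L` of `u := V_ℓ(Alb T_g) : V_L → V_K` that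
is a similitude with the right weight: `eV K (x, u z) = eV L (t x, z)` and `w L • eV L (t a, t b) = w K • eV K (a, b)` (for Jacobians: `u = V_ℓ(Nm)`,
`t = V_ℓ(T_g^*)`, [LangeRodriguez2022 §3.2 (3.3)] «`\widehat{f^*} = Nm_f`» and Prop. 3.2.1 (a) «`(f^*)^*Θ̃ ≡ d·Θ`», `w K = [K₀:K]⁻¹`).  OUTPUT: a bilinear
form `B` on `C.etaleH1Tower ℓ` with `B ([φ]_K, [ψ]_K) = w K • (eV K)^(φ, ψ)` (`^` = ★ `inverseForm`, Bourbaki's *forme inverse* on `(V_K)^∨ =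
C.etaleH1 ℓ K`), invariant under the Hecke action `T.etHeckeRep ℓ`.

* §1 **`HeckeTranslates.exists_bilinForm_etaleH1Tower_of_adjoint`** — the packaged V-side socket (★ (T2b) `exists_bilinForm_etaleH1Tower` fed with
  ★ (T2c) `smul_inverseForm_dualMap_dualMap`).
* §2 for ANY `B` with the level formula `hB : B ([φ]_K, [ψ]_K) = w K • (eV K)^(φ, ψ)`: `bilinForm_self_eq_zero_of_isAlt` (alternating levels ⇒
  alternating `B`), `bilinForm_separatingLeft_of_inverseForm` / `…Right…` (non-zero weights ⇒ separating `B`; ★ `nondegenerate_inverseForm`).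
* §3 `bilinForm_towerRep_of_similitude` — if `Γ_E` acts on the `eV K` by similitudes with multiplier `χ σ` (`eV K (σx, σy) = χ σ • eV K (x, y)`, the
  `ℓ`-adic Weil pairing with `χ = χ_ℓ`), then `B (σ·x, σ·y) = (χ σ)⁻¹ • B (x, y)` for the tower action ★ `towerRep` (the dual representation
  `C.etaleH1Rep = (rationalTateRep)^∨`, ★ `etaleH1Rep_apply`; ★ (T2c) `inverseForm_dualMap_dualMap_of_similitude` + ★ (T2b) `bilinForm_towerRep`).

## References
* [Liu2021] Y. Liu, *Fourier–Jacobi cycles and arithmetic relative trace formula*, Camb. J. Math. 9 (2021) (`FJcycle.tex`): §4.2 «Albanese of unitary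
  Shimura varieties», l. 2066–2081 and l. 2152–2160 (print pp. 49–50).
* [BourbakiAlgebreIX2007] N. Bourbaki, *Algèbre, Chapitre 9*, §1 no. 7 formula (27) (forme inverse), no. 8 (31), (34) (adjoints).
* Tree: ★ (T2a) `Literature.LinearAlgebra.DirectLimit.BilinFormOfCompatibleFamily`, ★ (T2b) `AppendixC.EtaleH1TowerPairing` (`exists_bilinForm_etaleH1Tower`,
  `bilinForm_self_eq_zero`, `bilinForm_separatingLeft/Right`, `bilinForm_towerRep`), ★ (T2c) `Literature.LinearAlgebra.InverseBilinearFormTransport`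
  (`smul_inverseForm_dualMap_dualMap`, `inverseForm_self_eq_zero_of`, `nondegenerate_inverseForm`, `inverseForm_dualMap_dualMap_of_similitude`),
  ★ `AppendixC.EtaleH1Tower` (`etaleH1Rep_apply`, `towerRep`), ★ `AppendixC.HeckeTranslates` (`albTr`), ★ `Motives.TateAbelianFiniteSteps` (`rationalTateModuleMap`).
-/

set_option autoImplicit false

open CategoryTheory NumberField

namespace Literature.NumberTheory.Automorphic.Liu2021.AppendixC

open Literature.AlgebraicGeometry.Motives (AbelianVariety)
open Literature.AlgebraicGeometry.Motives.AbelianVariety (rationalTateModuleMap)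
open Literature.LinearAlgebra

variable {F E : Type} [Field F] [NumberField F] [IsTotallyReal F] [Field E] [NumberField E] [Algebra F E]
  [IsTotallyComplex E] [Algebra.IsQuadraticExtension F E]
variable {P5 : PropC5Data F E} {isotropicAt : ℕ → Prop}

/-! ## §1 The packaged V-side socket -/

namespace Sec42Data.HeckeTranslates

variable {C : Sec42Data P5 isotropicAt} (T : C.HeckeTranslates) (ℓ : ℕ) [Fact ℓ.Prime]

/-- **The invariant form on `H¹_ét(A_∞)` from level pairings on `V_ℓ A_K` and adjoints along the translates.**  Given, at every sufficiently
small level `K`, a bilinear form `eV K` on `V_ℓ(A_K)` with bijective associated maps, weights `w K`, and for every translate `T_g : X_L → X_K`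
(`g⁻¹Lg ⊆ K`) a map `t : V_ℓ(A_K) → V_ℓ(A_L)` ADJOINT to `V_ℓ(Alb T_g)` (`eV K (x, V_ℓ(Alb T_g) z) = eV L (t x, z)`) and a weighted similitude
(`w L • eV L (t a, t b) = w K • eV K (a, b)`), there is a bilinear form `B` on the tower with `B ([φ]_K, [ψ]_K) = w K • (eV K)^(φ, ψ)` (`^` = the inverse
form on `(V_ℓ A_K)^∨ = H¹_ét(A_K)`) and `B (g·x, g·y) = B (x, y)` for the Hecke action of the translates.  (★ (T2b) `exists_bilinForm_etaleH1Tower`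
whose ONE law `hT` is supplied translate by translate by ★ (T2c) `smul_inverseForm_dualMap_dualMap`.)  Ours, on the tree's tower.
[cite: Liu2021, §4.2 (FJcycle.tex l. 2070–2074 and l. 2158–2160; print pp. 49–50)] [cite: BourbakiAlgebreIX2007, §1 no. 7 formula (27) and no. 8 formulas (31), (34)] -/
theorem exists_bilinForm_etaleH1Tower_of_adjoint
    (eV : ∀ K : C5.SmallLevel C.S.K₀, LinearMap.BilinForm ℚ_[ℓ] ((C.A K).rationalTateModule ℓ))
    [∀ K : C5.SmallLevel C.S.K₀, (eV K).IsPerfPair] (w : C5.SmallLevel C.S.K₀ → ℚ_[ℓ])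
    (hV : ∀ (g : C.G) (L K : C5.SmallLevel C.S.K₀) (hLK : C5.HeckeLE g L K),
      ∃ t : (C.A K).rationalTateModule ℓ →ₗ[ℚ_[ℓ]] (C.A L).rationalTateModule ℓ,
        (∀ (x : (C.A K).rationalTateModule ℓ) (z : (C.A L).rationalTateModule ℓ),
            eV K x (rationalTateModuleMap ℓ (T.albTr g L K hLK) z) = eV L (t x) z) ∧
        ∀ a b : (C.A K).rationalTateModule ℓ, w L • eV L (t a) (t b) = w K • eV K a b) :
    ∃ B : LinearMap.BilinForm ℚ_[ℓ] (C.etaleH1Tower ℓ),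
      (∀ (K : C5.SmallLevel C.S.K₀) (φ ψ : C.etaleH1 ℓ K),
          B (C.toTower ℓ K φ) (C.toTower ℓ K ψ) = w K • inverseForm (eV K) φ ψ) ∧
      ∀ (g : C.G) (x y : C.etaleH1Tower ℓ), B (T.etHeckeRep ℓ g x) (T.etHeckeRep ℓ g y) = B x y :=
  T.exists_bilinForm_etaleH1Tower ℓ (fun K => inverseForm (eV K)) w fun g L K hLK φ ψ => by
    obtain ⟨t, hadj, hw⟩ := hV g L K hLK
    exact smul_inverseForm_dualMap_dualMap (eV K) (eV L) (rationalTateModuleMap ℓ (T.albTr g L K hLK)) t hadj (w K) (w L) hw φ ψ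

end Sec42Data.HeckeTranslates

/-! ## §2 Alternation and separation from the level pairings -/

namespace Sec42Data

variable (C : Sec42Data P5 isotropicAt) (ℓ : ℕ) [Fact ℓ.Prime]

/-- If every level pairing is alternating (`eV K (x, x) = 0`, the Weil case), the tower form with `B ([φ]_K, [ψ]_K) = w K • (eV K)^(φ, ψ)` is
alternating (★ (T2c) `inverseForm_self_eq_zero_of` + ★ (T2b) `bilinForm_self_eq_zero`).  Ours.
[cite: Liu2021, §4.2 (FJcycle.tex l. 2158; print pp. 49–50)] [cite: BourbakiAlgebreIX2007, §1 no. 7 formula (27)] -/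
theorem bilinForm_self_eq_zero_of_isAlt
    {eV : ∀ K : C5.SmallLevel C.S.K₀, LinearMap.BilinForm ℚ_[ℓ] ((C.A K).rationalTateModule ℓ)}
    [∀ K : C5.SmallLevel C.S.K₀, (eV K).IsPerfPair] {w : C5.SmallLevel C.S.K₀ → ℚ_[ℓ]}
    {B : LinearMap.BilinForm ℚ_[ℓ] (C.etaleH1Tower ℓ)}
    (hB : ∀ (K : C5.SmallLevel C.S.K₀) (φ ψ : C.etaleH1 ℓ K), B (C.toTower ℓ K φ) (C.toTower ℓ K ψ) = w K • inverseForm (eV K) φ ψ)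
    (halt : ∀ (K : C5.SmallLevel C.S.K₀) (x : (C.A K).rationalTateModule ℓ), eV K x x = 0)
    (x : C.etaleH1Tower ℓ) : B x x = 0 :=
  C.bilinForm_self_eq_zero ℓ (e := fun K => inverseForm (eV K)) hB (fun K φ => inverseForm_self_eq_zero_of (eV K) (halt K) φ) x

/-- If the weights are non-zero, the tower form with `B ([φ]_K, [ψ]_K) = w K • (eV K)^(φ, ψ)` is LEFT-separating (`B (x, ·) = 0 ⇒ x = 0`): each
inverse form is non-degenerate (★ (T2c) `nondegenerate_inverseForm`) and separation passes to the tower (★ (T2b) `bilinForm_separatingLeft`).  Ours.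
[cite: Liu2021, §4.2 (FJcycle.tex l. 2158; print pp. 49–50)] [cite: BourbakiAlgebreIX2007, §1 no. 7 (after (27))] -/
theorem bilinForm_separatingLeft_of_inverseForm
    {eV : ∀ K : C5.SmallLevel C.S.K₀, LinearMap.BilinForm ℚ_[ℓ] ((C.A K).rationalTateModule ℓ)}
    [∀ K : C5.SmallLevel C.S.K₀, (eV K).IsPerfPair] {w : C5.SmallLevel C.S.K₀ → ℚ_[ℓ]}
    {B : LinearMap.BilinForm ℚ_[ℓ] (C.etaleH1Tower ℓ)}
    (hB : ∀ (K : C5.SmallLevel C.S.K₀) (φ ψ : C.etaleH1 ℓ K), B (C.toTower ℓ K φ) (C.toTower ℓ K ψ) = w K • inverseForm (eV K) φ ψ)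
    (hw : ∀ K : C5.SmallLevel C.S.K₀, w K ≠ 0)
    (x : C.etaleH1Tower ℓ) (hx : ∀ y : C.etaleH1Tower ℓ, B x y = 0) : x = 0 :=
  C.bilinForm_separatingLeft ℓ (e := fun K => inverseForm (eV K)) hB hw
    (fun K φ hφ => (nondegenerate_inverseForm (eV K)).1 φ hφ) x hx

/-- The mirror statement: non-zero weights ⇒ the tower form is RIGHT-separating (`B (·, y) = 0 ⇒ y = 0`).  Ours.
[cite: Liu2021, §4.2 (FJcycle.tex l. 2158; print pp. 49–50)] [cite: BourbakiAlgebreIX2007, §1 no. 7 (after (27))] -/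
theorem bilinForm_separatingRight_of_inverseForm
    {eV : ∀ K : C5.SmallLevel C.S.K₀, LinearMap.BilinForm ℚ_[ℓ] ((C.A K).rationalTateModule ℓ)}
    [∀ K : C5.SmallLevel C.S.K₀, (eV K).IsPerfPair] {w : C5.SmallLevel C.S.K₀ → ℚ_[ℓ]}
    {B : LinearMap.BilinForm ℚ_[ℓ] (C.etaleH1Tower ℓ)}
    (hB : ∀ (K : C5.SmallLevel C.S.K₀) (φ ψ : C.etaleH1 ℓ K), B (C.toTower ℓ K φ) (C.toTower ℓ K ψ) = w K • inverseForm (eV K) φ ψ)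
    (hw : ∀ K : C5.SmallLevel C.S.K₀, w K ≠ 0)
    (y : C.etaleH1Tower ℓ) (hy : ∀ x : C.etaleH1Tower ℓ, B x y = 0) : y = 0 :=
  C.bilinForm_separatingRight ℓ (e := fun K => inverseForm (eV K)) hB hw
    (fun K ψ hψ => (nondegenerate_inverseForm (eV K)).2 ψ hψ) y hy

/-! ## §3 Galois: similitudes on `V_ℓ A_K` ⇒ the inverse multiplier on the tower -/

/-- The dual Galois action on `H¹_ét(A_K) = (V_ℓ A_K)^∨` is the transpose of `ρ(σ⁻¹)`: `σ · φ = ᵗ(ρ σ⁻¹) φ` (★ `etaleH1Rep_apply`, as linear maps).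
Ours. [cite: Liu2021, §4.2 (FJcycle.tex l. 2160; print pp. 49–50)] -/
theorem etaleH1Rep_eq_dualMap (K : C5.SmallLevel C.S.K₀) (σ : Field.absoluteGaloisGroup E) (φ : C.etaleH1 ℓ K) :
    C.etaleH1Rep ℓ K σ φ = (((C.A K).rationalTateRep ℓ σ⁻¹ : _) : (C.A K).rationalTateModule ℓ →ₗ[ℚ_[ℓ]] _).dualMap φ := by
  refine LinearMap.ext fun v => ?_
  rw [C.etaleH1Rep_apply, LinearMap.dualMap_apply]

/-- **Galois equivariance with the inverse multiplier**: if `Γ_E` acts on every level pairing by similitudes with a common multiplier —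
`eV K (σx, σy) = χ σ • eV K (x, y)` for the Galois action `ρ = rationalTateRep` on `V_ℓ(A_K)` (the `ℓ`-adic Weil pairing, `χ = χ_ℓ`) — then the
tower form with `B ([φ]_K, [ψ]_K) = w K • (eV K)^(φ, ψ)` satisfies `B (σ·x, σ·y) = (χ σ)⁻¹ • B (x, y)` for ★ `towerRep` (the inverse forms carry the
inverse multiplier under the contragredient, ★ (T2c) `inverseForm_dualMap_dualMap_of_similitude`; passage to the tower ★ (T2b) `bilinForm_towerRep`).
Ours. [cite: Liu2021, §4.2 (FJcycle.tex l. 2158–2160; print pp. 49–50)] [cite: BourbakiAlgebreIX2007, §1 no. 8 Prop. 7, Remarque (34)] -/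
theorem bilinForm_towerRep_of_similitude
    {eV : ∀ K : C5.SmallLevel C.S.K₀, LinearMap.BilinForm ℚ_[ℓ] ((C.A K).rationalTateModule ℓ)}
    [∀ K : C5.SmallLevel C.S.K₀, (eV K).IsPerfPair] {w : C5.SmallLevel C.S.K₀ → ℚ_[ℓ]}
    {B : LinearMap.BilinForm ℚ_[ℓ] (C.etaleH1Tower ℓ)}
    (hB : ∀ (K : C5.SmallLevel C.S.K₀) (φ ψ : C.etaleH1 ℓ K), B (C.toTower ℓ K φ) (C.toTower ℓ K ψ) = w K • inverseForm (eV K) φ ψ)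
    (χ : Field.absoluteGaloisGroup E → ℚ_[ℓ]ˣ)
    (hχ : ∀ (K : C5.SmallLevel C.S.K₀) (σ : Field.absoluteGaloisGroup E) (x y : (C.A K).rationalTateModule ℓ),
      eV K ((C.A K).rationalTateRep ℓ σ x) ((C.A K).rationalTateRep ℓ σ y) = (χ σ : ℚ_[ℓ]) • eV K x y)
    (σ : Field.absoluteGaloisGroup E) (x y : C.etaleH1Tower ℓ) :
    B (C.towerRep ℓ σ x) (C.towerRep ℓ σ y) = (((χ σ)⁻¹ : ℚ_[ℓ]ˣ) : ℚ_[ℓ]) • B x y := by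
  refine C.bilinForm_towerRep ℓ (e := fun K => inverseForm (eV K)) hB (fun τ => (((χ τ)⁻¹ : ℚ_[ℓ]ˣ) : ℚ_[ℓ])) (fun K τ φ ψ => ?_) σ x y
  have hg : ∀ z : (C.A K).rationalTateModule ℓ,
      (C.A K).rationalTateRep ℓ τ ((C.A K).rationalTateRep ℓ τ⁻¹ z) = z := fun z => by
    rw [← Module.End.mul_apply, ← map_mul, mul_inv_cancel, map_one, Module.End.one_apply]
  rw [C.etaleH1Rep_eq_dualMap ℓ K τ φ, C.etaleH1Rep_eq_dualMap ℓ K τ ψ,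
    inverseForm_dualMap_dualMap_of_similitude (eV K) _ _ hg (χ τ) (hχ K τ) φ ψ, Units.smul_def]

end Sec42Data

end Literature.NumberTheory.Automorphic.Liu2021.AppendixC
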